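import Summits.QuantumAdvantage.AdviceFreeQNC0.TwistBound
import HarnessLib

/-!
# OddPrimeWalk — `TwistBound` ON A FIBRE (item stmt-QuantumAdvantage-24323 `FibreTwistBoundFive`), part 1: the pinned transfer

Cell qa-qnc0, route OddPrimeWalk (planner qa-qnc0-p2 g32, PROOF-MC §4 / Sketch32c; serves `ColumnResolutionRungFive` 24278 and
`MultiCounterRungFive` 24257).  Prover qn-prover-3 g20.

THEOREM `oddPrimeWalk_fibreTwistBoundFive` (route-file signature, verbatim): with the bits in `S` pinned to `π`, the twisted WIN-sum of
an OBLIVIOUS firing set `Y` over the free bits obeys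
`‖Σ_{u : u|_S = π} [WIN_Y(u)]·e₅(Σ_{u_i} β_i)‖ ≤ 3√6·cos(π/15)^{#(supp β ∖ S)}·2^{n−|S|}`; general prime `p ≠ 3`: `fibreTwistBound`.

PROOF = the tree's twisted transfer (`TwistedTransfer.corr_win_le`, planner p2 g15 / qn-lit g18 / prover g10) with a SITE MODE:
at a free site the step is the twisted average `T_ζ v(s) = (v(s+1) + ζ v(s+2))/2` (contracting by `cos(π/3p)` when the phase is
non-trivial: `TwoModuli.sum_norm_sq_twistStep_three_le` via `twistBound`'s site lemma), at a pinned site it is the SINGLE branch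
`v(s+1)` or `ζ·v(s+2)` (norm `≤ 1`).  `twisted_pathSum_fibre`: the fibre path sum equals `2^{#free}·TBVM`; `cnsq_TBVM_le`: norms
multiply; assembly as in `corr_win_le` (`sgnU_eq_sum`, `[WIN] = (1 − sgnU)/2`).
WHAT THIS IS NOT: no statement about non-oblivious strategies; the rungs 24278/24257 need the cell expansion on top.
-/

noncomputable section

namespace Summit.QuantumAdvantage.AdviceFreeQNC0

open Finset Literature.Computability.MetaComplexity

namespace TwistedTransfer

open ConstBells

variable {n : ℕ}

/-! ### Site modes and the pinned transfer -/

/-- One step at site `g`: free (`none`: twisted average of both branches), pinned to `0` (stay branch), pinned to `1`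
(move branch with its phase). -/
def stepM (mode : ℕ → Option Bool) (ζ : ℕ → ℂ) (g : ℕ) (v : ZMod 3 → ℂ) : ZMod 3 → ℂ :=
  match mode g with
  | none => twAvg (ζ g) v
  | some false => fun s => v (s + 1)
  | some true => fun s => ζ g * v (s + 2)

/-- The pinned twisted backward vector. -/
def TBVM (mode : ℕ → Option Bool) (ζ : ℕ → ℂ) (f : ℕ → ZMod 3 → ℝ) : ℕ → ℕ → ZMod 3 → ℂ
  | g, 0 => fun s => (f g s : ℂ)
  | g, k + 1 => rMul (f g) (stepM mode ζ g (TBVM mode ζ f (g + 1) k))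

/-- `TBVM` with no step left. -/
theorem TBVM_zero (mode : ℕ → Option Bool) (ζ : ℕ → ℂ) (f : ℕ → ZMod 3 → ℝ) (g : ℕ) :
    TBVM mode ζ f g 0 = fun s => (f g s : ℂ) := rfl

/-- `TBVM` recursion. -/
theorem TBVM_succ (mode : ℕ → Option Bool) (ζ : ℕ → ℂ) (f : ℕ → ZMod 3 → ℝ) (g k : ℕ) :
    TBVM mode ζ f g (k + 1) = rMul (f g) (stepM mode ζ g (TBVM mode ζ f (g + 1) k)) := rfl

/-- Admissible bit strings at offset `g`: they agree with the pinned values. -/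
abbrev Adm (mode : ℕ → Option Bool) (g k : ℕ) (u : Fin k → Bool) : Prop :=
  ∀ i : Fin k, ∀ b : Bool, mode (g + i.val) = some b → u i = b

/-- Peeling the first bit of an admissible string. -/
theorem adm_cons (mode : ℕ → Option Bool) (g k : ℕ) (b : Bool) (u : Fin k → Bool) :
    Adm mode g (k + 1) (Fin.cons b u : Fin (k + 1) → Bool) ↔
      (∀ b', mode g = some b' → b = b') ∧ Adm mode (g + 1) k u := by
  constructor
  · intro h
    refine ⟨fun b' hb' => ?_, fun i b' hb' => ?_⟩
    · have := h 0 b' (by simpa using hb')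
      simpa using this
    · have := h i.succ b' (by rw [Fin.val_succ, ← Nat.add_assoc, Nat.add_right_comm]; exact hb')
      simpa using this
  · rintro ⟨h0, h1⟩ i b' hb'
    refine Fin.cases ?_ (fun j hj => ?_) i hb'
    · intro hb0; simp only [Fin.val_zero, Nat.add_zero] at hb0; simpa using h0 b' hb0
    · simp only [Fin.cons_succ]
      exact h1 j b' (by rw [Fin.val_succ] at hj; rw [Nat.add_assoc, Nat.add_comm 1]; exact hj)

/-- The number of free sites among `g, …, g + k − 1`. -/
def freeCnt (mode : ℕ → Option Bool) (g k : ℕ) : ℕ := ((range k).filter fun i => mode (g + i) = none).card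

/-- `freeCnt` recursion (peel site `g`). -/
theorem freeCnt_succ (mode : ℕ → Option Bool) (g k : ℕ) :
    freeCnt mode g (k + 1) = freeCnt mode (g + 1) k + (if mode g = none then 1 else 0) := by
  unfold freeCnt
  rw [card_filter, card_filter, sum_range_succ', Nat.add_zero]
  congr 1
  refine sum_congr rfl fun i _ => ?_
  rw [show g + (i + 1) = g + 1 + i from by omega]

/-- `W_0 = 0`. -/
private theorem wtPrefix_zero₂ {m : ℕ} (u : Fin m → Bool) : wtPrefix u 0 = 0 := by
  unfold wtPrefix
  rw [Finset.card_eq_zero, Finset.filter_eq_empty_iff]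
  intro i _ h
  exact absurd h.1 (Nat.not_lt_zero _)

/-- **Pinned twisted path sum = pinned twisted backward vector**:
`Σ_{u admissible} (Π_{j ≤ k} f_{g+j}(s + j + W_j(u))) · Π_{i<k} ζ_{g+i}^{[u_i]} = 2^{#free} · TBVM_g k s`. -/
theorem twisted_pathSum_fibre (mode : ℕ → Option Bool) (ζ : ℕ → ℂ) (f : ℕ → ZMod 3 → ℝ) (k : ℕ) :
    ∀ (g : ℕ) (s : ZMod 3),
    (∑ u ∈ univ.filter (Adm mode g k),
        ((∏ j ∈ range (k + 1), f (g + j) (s + ((j + wtPrefix u j : ℕ) : ZMod 3)) : ℝ) : ℂ) *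
          ∏ i : Fin k, (if u i then ζ (g + i.val) else 1)) =
      2 ^ freeCnt mode g k * TBVM mode ζ f g k s := by
  induction k with
  | zero =>
    intro g s
    rw [TBVM_zero]
    have hadm : univ.filter (Adm mode g 0) = univ := by
      ext u; simp [Adm]
    rw [hadm]
    simp [wtPrefix_zero₂, freeCnt]
  | succ k ih =>
    intro g s
    rw [TBVM_succ, sum_filter]
    rw [← Fintype.sum_equiv (Fin.consEquiv fun _ : Fin (k + 1) => Bool)
      (fun p : Bool × (Fin k → Bool) => if Adm mode g (k + 1) (Fin.cons p.1 p.2 : Fin (k + 1) → Bool) then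
        ((∏ j ∈ range (k + 1 + 1),
          f (g + j) (s + ((j + wtPrefix (Fin.cons p.1 p.2 : Fin (k + 1) → Bool) j : ℕ) : ZMod 3)) : ℝ) : ℂ) *
          ∏ i : Fin (k + 1), (if (Fin.cons p.1 p.2 : Fin (k + 1) → Bool) i then ζ (g + i.val) else 1) else 0)
      _ (fun p => rfl), Fintype.sum_prod_type]
    -- the inner sums, for each first bit `b`
    have hinner : ∀ b : Bool, (∑ u' : Fin k → Bool,
        if Adm mode g (k + 1) (Fin.cons b u' : Fin (k + 1) → Bool) then
          ((∏ j ∈ range (k + 1 + 1),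
            f (g + j) (s + ((j + wtPrefix (Fin.cons b u' : Fin (k + 1) → Bool) j : ℕ) : ZMod 3)) : ℝ) : ℂ) *
            ∏ i : Fin (k + 1), (if (Fin.cons b u' : Fin (k + 1) → Bool) i then ζ (g + i.val) else 1) else 0) =
        if (∀ b', mode g = some b' → b = b') then
          (f g s : ℂ) * (if b then ζ g else 1) *
            (2 ^ freeCnt mode (g + 1) k * TBVM mode ζ f (g + 1) k (s + 1 + ((b.toNat : ℕ) : ZMod 3))) else 0 := by
      intro b
      by_cases hb : ∀ b', mode g = some b' → b = b'
      · rw [if_pos hb, ← ih (g + 1) (s + 1 + ((b.toNat : ℕ) : ZMod 3)), sum_filter, Finset.mul_sum]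
        refine Finset.sum_congr rfl fun u' _ => ?_
        by_cases hu : Adm mode (g + 1) k u'
        · rw [if_pos hu, if_pos ((adm_cons mode g k b u').mpr ⟨hb, hu⟩)]
          rw [Finset.prod_range_succ' _ (k + 1), Fin.prod_univ_succ]
          simp only [Fin.cons_zero, Fin.cons_succ, Fin.val_zero, add_zero, Fin.val_succ]
          have hfac : ∀ j ∈ range (k + 1), f (g + (j + 1)) (s + (((j + 1) +
              wtPrefix (Fin.cons b u' : Fin (k + 1) → Bool) (j + 1) : ℕ) : ZMod 3)) =
              f (g + 1 + j) (s + 1 + ((b.toNat : ℕ) : ZMod 3) + ((j + wtPrefix u' j : ℕ) : ZMod 3)) := by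
            intro j _
            rw [wtPrefix_cons_succ]
            congr 1
            · ring
            · push_cast; ring
          rw [Finset.prod_congr rfl hfac]
          simp only [wtPrefix_zero₂, Nat.cast_zero, add_zero]
          have hg : ∀ i : Fin k, g + (i.val + 1) = g + 1 + i.val := fun i => by ring
          simp only [hg]
          push_cast
          ring
        · rw [if_neg hu, if_neg (fun h => hu ((adm_cons mode g k b u').mp h).2), mul_zero]
      · rw [if_neg hb]
        refine Finset.sum_eq_zero fun u' _ => ?_
        rw [if_neg]
        rw [adm_cons]
        exact fun h => hb h.1
    rw [Fintype.sum_bool, hinner true, hinner false, freeCnt_succ, pow_add]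
    simp only [Bool.toNat_true, Bool.toNat_false, Nat.cast_one, Nat.cast_zero, add_zero, if_true,
      show s + 1 + (1 : ZMod 3) = s + 2 from by ring]
    -- case on the mode of site `g`
    unfold stepM
    cases hm : mode g with
    | none =>
      have P : ∀ b : Bool, (∀ b', (none : Option Bool) = some b' → b = b') := fun b b' h => by cases h
      rw [if_pos (P true), if_pos (P false), if_pos rfl]
      simp only [Bool.false_eq_true, if_false, pow_one, mul_one]
      unfold rMul twAvg
      ring
    | some b₀ =>
      have P : ∀ b : Bool, (∀ b', (some b₀ : Option Bool) = some b' → b = b') ↔ b = b₀ :=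
        fun b => ⟨fun h => h b₀ rfl, fun h b' hb' => by cases hb'; exact h⟩
      simp only [P, reduceCtorEq, if_false, pow_zero, mul_one]
      cases b₀
      · simp only [Bool.true_eq_false, if_false, if_true, zero_add]
        unfold rMul
        ring
      · simp only [Bool.false_eq_true, if_false, if_true, add_zero]
        unfold rMul
        ring

/-! ### Norm propagation -/

/-- Addition table of `ZMod 3`, `+1`. -/
private theorem z3_add1'' : ((0 : ZMod 3) + 1 = 1) ∧ ((1 : ZMod 3) + 1 = 2) ∧ ((2 : ZMod 3) + 1 = 0) := by decide
/-- Addition table of `ZMod 3`, `+2`. -/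
private theorem z3_add2'' : ((0 : ZMod 3) + 2 = 2) ∧ ((1 : ZMod 3) + 2 = 0) ∧ ((2 : ZMod 3) + 2 = 1) := by decide

/-- A pinned step does not expand the norm (phases of modulus `≤ 1`). -/
theorem cnsq_stepM_pinned_le (mode : ℕ → Option Bool) (ζ : ℕ → ℂ) (hζ : ∀ g, ‖ζ g‖ ≤ 1) (g : ℕ) (b : Bool)
    (hm : mode g = some b) (v : ZMod 3 → ℂ) : cnsq (stepM mode ζ g v) ≤ cnsq v := by
  unfold stepM
  rw [hm]
  cases b
  · simp only [cnsq]
    rw [z3_add1''.1, z3_add1''.2.1, z3_add1''.2.2]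
    linarith
  · simp only [cnsq]
    rw [z3_add2''.1, z3_add2''.2.1, z3_add2''.2.2, norm_mul, norm_mul, norm_mul]
    have h := hζ g
    have h0 : 0 ≤ ‖ζ g‖ := norm_nonneg _
    have hsq : ‖ζ g‖ ^ 2 ≤ 1 := by nlinarith
    nlinarith [sq_nonneg ‖v 0‖, sq_nonneg ‖v 1‖, sq_nonneg ‖v 2‖]

/-- Along the whole pinned walk: `‖TBVM_g k‖² ≤ (Π_{i<k} ρ_{g+i}²) · ‖f_{g+k}‖²`, given per-site factors `ρ`. -/
theorem cnsq_TBVM_le (mode : ℕ → Option Bool) (ζ : ℕ → ℂ) (f : ℕ → ZMod 3 → ℝ) (hf : ∀ g s, f g s ^ 2 ≤ 1)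
    (ρ : ℕ → ℝ) (hρ : ∀ g v, cnsq (stepM mode ζ g v) ≤ ρ g ^ 2 * cnsq v) (k : ℕ) :
    ∀ g, cnsq (TBVM mode ζ f g k) ≤ (∏ i ∈ range k, ρ (g + i) ^ 2) * cnsq (TBVM mode ζ f (g + k) 0) := by
  induction k with
  | zero => intro g; simp
  | succ k ih =>
    intro g
    have hnonneg : 0 ≤ ρ g ^ 2 := sq_nonneg _
    have hstep : cnsq (TBVM mode ζ f g (k + 1)) ≤ ρ g ^ 2 * cnsq (TBVM mode ζ f (g + 1) k) := by
      rw [TBVM_succ]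
      exact (cnsq_rMul_le (hf g) _).trans (hρ g _)
    calc cnsq (TBVM mode ζ f g (k + 1)) ≤ ρ g ^ 2 * cnsq (TBVM mode ζ f (g + 1) k) := hstep
      _ ≤ ρ g ^ 2 * ((∏ i ∈ range k, ρ (g + 1 + i) ^ 2) * cnsq (TBVM mode ζ f (g + 1 + k) 0)) :=
          mul_le_mul_of_nonneg_left (ih (g + 1)) hnonneg
      _ = (∏ i ∈ range (k + 1), ρ (g + i) ^ 2) * cnsq (TBVM mode ζ f (g + (k + 1)) 0) := by
          rw [Finset.prod_range_succ', add_zero, show g + 1 + k = g + (k + 1) from by ring]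
          have : ∀ i ∈ range k, ρ (g + 1 + i) ^ 2 = ρ (g + (i + 1)) ^ 2 := fun i _ => by
            rw [show g + 1 + i = g + (i + 1) from by ring]
          rw [Finset.prod_congr rfl this]; ring

end TwistedTransfer

end Summit.QuantumAdvantage.AdviceFreeQNC0

end
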